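import Summits.AtomisticToContinuum.BoseEinsteinCondensation.Theorems.BECConjugateDominationInfraredMinimumUncertaintySteinForm

/-!
# Route `BECConjugateDomination`, crux `InfraredMinimumUncertainty` (stmt-AtomisticToContinuum-11784),
# line `fisher-gaussian-density-mode`: the moment decomposition `m₂ = ‖k‖⁴(2N − N S_m) + 4‖D_mΨ‖²`

Supports (does not close) stmt-AtomisticToContinuum-11784. For a real-valued periodic `C¹` state `Ψ = u`, with the
longitudinal current amplitude `D_m(X) = ∑ⱼ e_m(xⱼ) ∂_{xⱼ·k}Ψ(X)`, the second energy-weighted moment of the density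
response decomposes EXACTLY as

  `m₂ = ∫|W_m|² = ‖k‖⁴ (2N − N S_m) + 4 ∫_{cell^N} |D_m|²`      (`secondMoment_decomposition`),

from the pointwise identity `|W|² = ‖k‖⁴u²|Z|² + 4|D|² + 4‖k‖²u ∑ⱼ ∂ⱼu·Im(Z̄eⱼ)` (`norm_sq_commutator_sum`) and
the per-particle by-parts identity `fsum_stepB` of `…FSum.lean`. Consequence for the line's density-side fallback:
Feynman saturation `(N S_m)·m₂ ≤ C N²‖k‖⁴` (FS ⇒ FG, proved in `…Ladder.lean`) is implied by, and for `S_m ≤ 2`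
equivalent up to constants to, the `S`-weighted longitudinal-current bound `S_m · ∫|D_m|² ≤ C' N ‖k‖⁴`
(Bogoliubov: `4∫|D_m|² = N‖k‖⁴(1 − S_m)²/S_m`, so the product is `N‖k‖⁴(1−S)²/4`): the density-side content
of the line is the suppression of longitudinal current fluctuations at the lowest modes (phase rigidity).
Algebra by stub-worker wave 1 (scratch `stub_densityFisherGaussianity_m2algebra.lean`), assembled by the lead.
-/

noncomputable section

open MeasureTheory Filter Set Metric
open scoped ENNReal NNReal Topology ComplexConjugate BigOperators

namespace Summit.AtomisticToContinuum.BoseEinsteinCondensation.Cruxes.InfraredMinimumUncertainty.FisherGaussianDensityMode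

open Literature.MathematicalPhysics.QuantumManyBody.BoseGas

section CommutatorAlgebra

variable {N : ℕ}

/-- `∑ⱼ e_j (κ u − 2i d_j) = κ u Z − 2i D` with `Z = ∑ⱼ e_j`, `D = ∑ⱼ e_j d_j`. [folklore] -/
theorem commutator_sum_eq (e : Fin N → ℂ) (d : Fin N → ℝ) (κ u : ℝ) :
    ∑ j, e j * (((κ : ℝ) : ℂ) * ((u : ℝ) : ℂ) - 2 * Complex.I * ((d j : ℝ) : ℂ)) =
      ((κ : ℝ) : ℂ) * ((u : ℝ) : ℂ) * ∑ j, e j - 2 * Complex.I * ∑ j, e j * ((d j : ℝ) : ℂ) := by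
  rw [Finset.mul_sum, Finset.mul_sum, ← Finset.sum_sub_distrib]
  exact Finset.sum_congr rfl fun j _ => by ring

/-- `|κuZ − 2iD|² = κ²u²|Z|² + 4|D|² + 4κu·Im(Z̄D)` for complex `Z, D` and real `κ, u`. [folklore] -/
theorem norm_sq_sub_two_I_mul (Z D : ℂ) (κ u : ℝ) :
    ‖((κ : ℝ) : ℂ) * ((u : ℝ) : ℂ) * Z - 2 * Complex.I * D‖ ^ 2 =
      κ ^ 2 * u ^ 2 * ‖Z‖ ^ 2 + 4 * ‖D‖ ^ 2 + 4 * κ * u * (starRingEnd ℂ Z * D).im := by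
  rw [Complex.sq_norm, Complex.sq_norm, Complex.sq_norm, Complex.normSq_apply, Complex.normSq_apply,
    Complex.normSq_apply]
  simp only [Complex.sub_re, Complex.sub_im, Complex.mul_re, Complex.mul_im, Complex.ofReal_re,
    Complex.ofReal_im, Complex.I_re, Complex.I_im, Complex.re_ofNat, Complex.im_ofNat,
    Complex.conj_re, Complex.conj_im]
  ring

/-- **Pointwise structure of `|W_m|²` for a real amplitude**:
`|∑ⱼ e_j(κu − 2i d_j)|² = κ²u²|∑ⱼ e_j|² + 4|∑ⱼ e_j d_j|² + 4κu ∑ⱼ d_j Im(conj(∑ₗ e_l) e_j)`. With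
`e_j = e_m(x_j)`, `u = Ψ(X)` real, `d_j = ∂_{x_j·k}Ψ(X)`, `κ = ‖k‖²` this is the integrand of `m₂`;
the last term is what the skeleton's `fsum_stepB` integrates by parts. [folklore] -/
theorem norm_sq_commutator_sum (e : Fin N → ℂ) (d : Fin N → ℝ) (κ u : ℝ) :
    ‖∑ j, e j * (((κ : ℝ) : ℂ) * ((u : ℝ) : ℂ) - 2 * Complex.I * ((d j : ℝ) : ℂ))‖ ^ 2 =
      κ ^ 2 * u ^ 2 * ‖∑ j, e j‖ ^ 2 + 4 * ‖∑ j, e j * ((d j : ℝ) : ℂ)‖ ^ 2 +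
        4 * κ * u * ∑ j, d j * (starRingEnd ℂ (∑ l, e l) * e j).im := by
  rw [commutator_sum_eq, norm_sq_sub_two_I_mul]
  congr 1
  rw [Finset.mul_sum, Complex.im_sum]
  congr 1
  refine Finset.sum_congr rfl fun j _ => ?_
  rw [← mul_assoc, Complex.im_mul_ofReal]
  ring

end CommutatorAlgebra

section MomentDecomposition

variable {N : ℕ} {L : ℝ}

/-- **Moment decomposition `m₂ = 2κ²N∫u² − κ²∫u²|Z|² + 4∫|D|²`**, for a real `C¹` amplitude `u`, phases
`e_j = e_m(x_j)`, a direction `k` and a real `κ`, CONDITIONAL on the per-particle by-parts identity `hB`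
(`∫ 2u ∂_{x_j·k}u · Im(Z̄e_j) = κ∫u² − κ∫u²Re(Z̄e_j)` for every `j`; this is the line skeleton's
`fsum_stepB` for lattice-periodic `u`, `k = waveVec L m`, `κ = ‖k‖²`, with `densityMode` unfolded).
For a normalised state (`∫u² = 1`, `∫u²|Z|² = N S_m`): `m₂ = κ²(2N − N S_m) + 4∫|D_m|²`. [folklore] -/
theorem secondMoment_decomposition_of_stepB (m : Fin 3 → ℤ) (k : Space) (κ : ℝ)
    {u : Config N → ℝ} (hu : ContDiff ℝ 1 u)
    (hB : ∀ j : Fin N,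
      ∫ X in cellN N L, 2 * u X * fderiv ℝ u X (Pi.single j k) *
          (starRingEnd ℂ (∑ l, cellWave L m (X l)) * cellWave L m (X j)).im =
        (κ * ∫ X in cellN N L, u X ^ 2) -
          κ * ∫ X in cellN N L, u X ^ 2 *
            (starRingEnd ℂ (∑ l, cellWave L m (X l)) * cellWave L m (X j)).re) :
    ∫ X in cellN N L, ‖∑ j, cellWave L m (X j) *
        (((κ : ℝ) : ℂ) * ((u X : ℝ) : ℂ) - 2 * Complex.I * ((fderiv ℝ u X (Pi.single j k) : ℝ) : ℂ))‖ ^ 2 =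
      2 * κ ^ 2 * N * (∫ X in cellN N L, u X ^ 2) -
        κ ^ 2 * (∫ X in cellN N L, u X ^ 2 * ‖∑ j, cellWave L m (X j)‖ ^ 2) +
        4 * ∫ X in cellN N L, ‖∑ j, cellWave L m (X j) * ((fderiv ℝ u X (Pi.single j k) : ℝ) : ℂ)‖ ^ 2 := by
  -- names for the pieces
  set Z : Config N → ℂ := fun X => ∑ l, cellWave L m (X l) with hZ
  set d : Fin N → Config N → ℝ := fun j X => fderiv ℝ u X (Pi.single j k) with hd
  set D : Config N → ℂ := fun X => ∑ j, cellWave L m (X j) * ((d j X : ℝ) : ℂ) with hD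
  set R : Fin N → Config N → ℝ := fun j X => (starRingEnd ℂ (Z X) * cellWave L m (X j)).re with hR
  set F : Fin N → Config N → ℝ := fun j X => (starRingEnd ℂ (Z X) * cellWave L m (X j)).im with hF
  -- pointwise expansion
  have hpt : ∀ X, ‖∑ j, cellWave L m (X j) *
      (((κ : ℝ) : ℂ) * ((u X : ℝ) : ℂ) - 2 * Complex.I * ((fderiv ℝ u X (Pi.single j k) : ℝ) : ℂ))‖ ^ 2 =
      κ ^ 2 * (u X ^ 2 * ‖Z X‖ ^ 2) + 4 * ‖D X‖ ^ 2 + 2 * κ * ∑ j, 2 * u X * d j X * F j X := by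
    intro X
    have h := norm_sq_commutator_sum (fun j => cellWave L m (X j)) (fun j => d j X) κ (u X)
    simp only [hZ, hD, hF, hd] at h ⊢
    rw [h, Finset.mul_sum, Finset.mul_sum]
    congr 1
    · ring
    · exact Finset.sum_congr rfl fun j _ => by ring
  simp_rw [hpt]
  -- continuity / integrability
  have hec : ∀ j : Fin N, Continuous fun X : Config N => cellWave L m (X j) := fun j =>
    (contDiff_cellWave L m).continuous.comp (continuous_apply j)
  have hZc : Continuous Z := continuous_finsetSum _ fun l _ => hec l
  have huc : Continuous u := hu.continuous
  have hdc : ∀ j, Continuous (d j) := fun j =>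
    (hu.continuous_fderiv one_ne_zero).clm_apply continuous_const
  have hDc : Continuous D :=
    continuous_finsetSum _ fun j _ => (hec j).mul (Complex.continuous_ofReal.comp (hdc j))
  have hRc : ∀ j, Continuous (R j) := fun j =>
    Complex.continuous_re.comp ((Complex.continuous_conj.comp hZc).mul (hec j))
  have hFc : ∀ j, Continuous (F j) := fun j =>
    Complex.continuous_im.comp ((Complex.continuous_conj.comp hZc).mul (hec j))
  have hi1 : Integrable (fun X => κ ^ 2 * (u X ^ 2 * ‖Z X‖ ^ 2)) (volume.restrict (cellN N L)) :=
    integrableOn_cellN (continuous_const.mul ((huc.pow 2).mul (hZc.norm.pow 2))) L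
  have hi2 : Integrable (fun X => 4 * ‖D X‖ ^ 2) (volume.restrict (cellN N L)) :=
    integrableOn_cellN (continuous_const.mul (hDc.norm.pow 2)) L
  have hi3j : ∀ j, Integrable (fun X => 2 * u X * d j X * F j X) (volume.restrict (cellN N L)) :=
    fun j => integrableOn_cellN (((continuous_const.mul huc).mul (hdc j)).mul (hFc j)) L
  have hi3 : Integrable (fun X => 2 * κ * ∑ j, 2 * u X * d j X * F j X) (volume.restrict (cellN N L)) :=
    (integrable_finsetSum _ fun j _ => hi3j j).const_mul _
  have hi4j : ∀ j, Integrable (fun X => u X ^ 2 * R j X) (volume.restrict (cellN N L)) :=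
    fun j => integrableOn_cellN ((huc.pow 2).mul (hRc j)) L
  have hi12 : Integrable (fun X => κ ^ 2 * (u X ^ 2 * ‖Z X‖ ^ 2) + 4 * ‖D X‖ ^ 2)
      (volume.restrict (cellN N L)) := hi1.add hi2
  rw [integral_add hi12 hi3, integral_add hi1 hi2, integral_const_mul, integral_const_mul,
    integral_const_mul, integral_finsetSum _ fun j _ => hi3j j]
  -- by parts, particle by particle
  have hBj : ∀ j : Fin N, ∫ X in cellN N L, 2 * u X * d j X * F j X =
      (κ * ∫ X in cellN N L, u X ^ 2) - κ * ∫ X in cellN N L, u X ^ 2 * R j X := fun j => hB j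
  simp_rw [hBj]
  rw [Finset.sum_sub_distrib, Finset.sum_const, Finset.card_univ, Fintype.card_fin, nsmul_eq_mul,
    ← Finset.mul_sum, ← integral_finsetSum _ fun j _ => hi4j j]
  -- `∑ⱼ Re(Z̄ e_j) = |Z|²`
  have hsumR : ∀ X, ∑ j, u X ^ 2 * R j X = u X ^ 2 * ‖Z X‖ ^ 2 := by
    intro X
    rw [← Finset.mul_sum]
    congr 1
    simp only [hR]
    rw [← Complex.re_sum, ← Finset.mul_sum, ← Complex.normSq_eq_norm_sq]
    show (starRingEnd ℂ (Z X) * Z X).re = Complex.normSq (Z X)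
    rw [← Complex.normSq_eq_conj_mul_self, Complex.ofReal_re]
  simp_rw [hsumR]
  ring

end MomentDecomposition

section Assembly

/-- **The moment decomposition** (registered sub-goal form): for a real-valued periodic `C¹` state of `n+1` bosons on
the torus of side `L > 0` and every mode `m`,
`m₂ = ‖k‖⁴ (2N − N S_m) + 4 ∫_{cell^N} |∑ⱼ e_m(xⱼ) ∂_{xⱼ·k}Ψ|²`. -/
theorem secondMoment_decomposition : ∀ (n : ℕ) (L : ℝ), 0 < L → ∀ (Ψ : PeriodicTrialState (n + 1) L),
    (∀ X, Ψ.ψ X = (‖Ψ.ψ X‖ : ℂ)) → ∀ (m : Fin 3 → ℤ),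
    secondMoment (n + 1) L Ψ.ψ m =
      ‖waveVec L m‖ ^ 4 * (2 * ((n : ℝ) + 1) - ((n : ℝ) + 1) * structureFactor n L Ψ m) +
        4 * ∫ X in cellN (n + 1) L,
          ‖∑ j : Fin (n + 1), cellWave L m (X j) * fderiv ℝ Ψ.ψ X (Pi.single j (waveVec L m))‖ ^ 2 := by
  intro n L hL Ψ hreal m
  set u : Config (n + 1) → ℝ := fun X => (Ψ.ψ X).re with hudef
  have hψu : ∀ X, Ψ.ψ X = ((u X : ℝ) : ℂ) := realAmp_eq Ψ hreal
  have hu_cd : ContDiff ℝ 1 u := contDiff_realAmp Ψ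
  have hu_per : IsLatticePeriodic L u := realAmp_periodic Ψ
  have hderiv : ∀ X v, fderiv ℝ Ψ.ψ X v = ((fderiv ℝ u X v : ℝ) : ℂ) := fderiv_realAmp Ψ hreal
  have hnorm : ∀ X, ‖Ψ.ψ X‖ ^ 2 = u X ^ 2 := norm_sq_realAmp Ψ hreal
  -- rewrite `m₂` and the current integrand over the real amplitude
  have hW : ∀ X, commutatorAmp (n + 1) L Ψ.ψ m X = ∑ j, cellWave L m (X j) *
      (((‖waveVec L m‖ ^ 2 : ℝ) : ℂ) * ((u X : ℝ) : ℂ) -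
        2 * Complex.I * ((fderiv ℝ u X (Pi.single j (waveVec L m)) : ℝ) : ℂ)) := by
    intro X
    unfold commutatorAmp
    refine Finset.sum_congr rfl fun j _ => ?_
    rw [hderiv, ← hψu X]
  have hDX : ∀ X, (∑ j : Fin (n + 1), cellWave L m (X j) * fderiv ℝ Ψ.ψ X (Pi.single j (waveVec L m))) =
      ∑ j, cellWave L m (X j) * ((fderiv ℝ u X (Pi.single j (waveVec L m)) : ℝ) : ℂ) := by
    intro X
    refine Finset.sum_congr rfl fun j _ => ?_
    rw [hderiv]
  unfold secondMoment
  simp_rw [hW, hDX]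
  rw [secondMoment_decomposition_of_stepB m (waveVec L m) (‖waveVec L m‖ ^ 2) hu_cd
    (fun j => fsum_stepB hL m hu_cd hu_per j)]
  -- `∫ u² = 1`, `∫ u²|Z|² = N S_m`
  have h1 : ∫ X in cellN (n + 1) L, u X ^ 2 = 1 := by
    have h := Summit.AtomisticToContinuum.BoseEinsteinCondensation.Theorems.StaticResponseBound.Negative.integral_norm_sq_eq_one Ψ
    simp_rw [hnorm] at h
    exact h
  have h2 : ∫ X in cellN (n + 1) L, u X ^ 2 * ‖∑ j, cellWave L m (X j)‖ ^ 2 =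
      ((n : ℝ) + 1) * structureFactor n L Ψ m := by
    rw [mul_structureFactor_eq]
    refine integral_congr_ae (Filter.Eventually.of_forall fun X => ?_)
    simp only [densityMode, hnorm]
    ring
  rw [h1, h2]
  push_cast
  ring

end Assembly

end Summit.AtomisticToContinuum.BoseEinsteinCondensation.Cruxes.InfraredMinimumUncertainty.FisherGaussianDensityMode

end
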